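import Literature.AlgebraicGeometry.Resolution.BoundaryHistoryFunction
import Literature.AlgebraicGeometry.Resolution.HilbertSamuelLowerBound
import HarnessLib

/-!
# CJS 2020, Ch. 4/6: the `O`-Hilbert–Samuel locus lies in the Hilbert–Samuel locus (Lemma 6.3 (b), proof) — order-theoretic API for `Σ^{O,max}`, `X^O_max`

Source: V. Cossart, U. Jannsen, S. Saito, *Desingularization: Invariants and Strategy. Application
to Dimension 2*, Lecture Notes in Math. 2270 (2020) [`CossartJannsenSaito2020`]: the
Hilbert–Samuel function `H^O_X(x) = (H_X(x), |O(x)|)` with the lexicographic order (Ch. 4,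
before Thm. 4.8, p. 55), Def. 4.9 (1) (`X^O(ν̃)`, `Σ^O_X`, `Σ^{O,max}_X`, `X^O_max`), and the
sentence in the proof of Lemma 6.3 (b) (p. 80): "let `ν̃ = (ν, m)`, with `ν ∈ ℕ^ℕ` and `m ≥ 0`.
Then `ν ∈ Σ^max_X` and `X^O(ν̃) ⊆ X(ν)`."  Continues `BoundaryHistoryFunction.lean`
(`BoundaryHistory.hsO`, `.SigmaO`, `.SigmaOMax`, `.hsOStratum`, `.hsOMaxLocus`), whose
definitions had no API yet; everything here is PROVED, nothing is vendored.

## Content (namespace `Literature.AlgebraicGeometry.Resolution.BoundaryHistory`)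

* bookkeeping: `ofLex_hsO_fst/snd`, `hsO_mem_sigmaO`, `mem_sigmaOMax_iff` (`Σ^{O,max}` =
  Mathlib's `Maximal (· ∈ Σ^O)`), `mem_hsOMaxLocus_iff`, `hsO_le_hsO_iff_of_eq`;
* **Lemma 6.3 (b), proof step** (abstract `H : X → ν` into a partial order, any `O`):
  `maximal_fst_of_mem_sigmaOMax` — if `ν̃ = (ν, m) ∈ Σ^{O,max}_X` then `ν ∈ Σ^max_X`;
  `hsOStratum_subset` — `X^O(ν̃) ⊆ X(ν)`; `hsOMaxLocus_subset_setOf_maximal` — `X^O_max ⊆ X_max`;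
* on a Mathlib scheme with `H = H_X^N` of Def. 2.28 (`Scheme.hsFun`, `HilbertSamuelStrata.lean`):
  `hsOMaxLocus_hsFun_subset_hsMaxLocus` (`X^O_max ⊆ X_max`) and, with Lemma 2.23/Rem. 2.32 from
  `HilbertSamuelLowerBound.lean`, `hsOMaxLocus_hsFun_subset_compl_regularLocus`: **for a
  non-regular `X`, `X^O_max ⊆ X ∖ X_reg`** — the centres `D ⊆ X^O_max` of a `Σ^{O,max}`- or
  `ν̃`-elimination (Def. 6.23) of a connected non-regular reduced `X` are made of singular points;
* the regular case (used when `H_X` is constant, Rem. 6.22 (c)): `mem_hsOMaxLocus_iff_of_const` —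
  if `H` is constant, `x ∈ X^O_max ↔ |O(y)| ≤ |O(x)|` for all `y` (finite histories), and
  `nonempty_of_mem_hsOMaxLocus_of_const` — then `O(x) ≠ ∅` as soon as some `O(y) ≠ ∅`.

## Sources

* V. Cossart, U. Jannsen, S. Saito, LNM 2270 (2020): Ch. 4 p. 55 (order on `H^O_X`), Def. 4.9 (1)
  (p. 55), Lemma 6.3 (b) with proof (p. 80), Def. 6.23 (p. 87), Rem. 6.22 (c) (p. 87), Def. 2.35,
  Rem. 2.32 (text read: held copy, chunks p0080, p0088). [CossartJannsenSaito2020]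
-/

noncomputable section

open Set AlgebraicGeometry

namespace Literature.AlgebraicGeometry.Resolution

namespace BoundaryHistory

variable {X : Type*} {ι : Type*} {ν : Type*}

/-! ## Bookkeeping for `H^O`, `Σ^O`, `Σ^{O,max}`, `X^O_max` -/

/-- The first coordinate of `H^O_X(x)` is `H_X(x)`. [cite: CossartJannsenSaito2020, Ch. 4, p. 55] -/
@[simp] theorem ofLex_hsO_fst (H : X → ν) (O : X → Set ι) (x : X) :
    (ofLex (hsO H O x)).1 = H x := rfl

/-- The second coordinate of `H^O_X(x)` is `|O(x)|`. [cite: CossartJannsenSaito2020, Ch. 4, p. 55] -/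
@[simp] theorem ofLex_hsO_snd (H : X → ν) (O : X → Set ι) (x : X) :
    (ofLex (hsO H O x)).2 = (O x).ncard := rfl

/-- `H^O_X(x) ∈ Σ^O_X`. [cite: CossartJannsenSaito2020, Def. 4.9 (1)] -/
theorem hsO_mem_sigmaO (H : X → ν) (O : X → Set ι) (x : X) : hsO H O x ∈ SigmaO H O := ⟨x, rfl⟩

/-- `Σ^{O,max}_X` is the set of maximal elements of `Σ^O_X` in Mathlib's sense (`Maximal`).
[cite: CossartJannsenSaito2020, Def. 4.9 (1)] -/
theorem mem_sigmaOMax_iff [LT ν] {H : X → ν} {O : X → Set ι} {a : ν ×ₗ ℕ} :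
    a ∈ SigmaOMax H O ↔ Maximal (· ∈ SigmaO H O) a :=
  ⟨fun h => ⟨h.1, fun _ hb hab => h.2 _ hb hab⟩, fun h => ⟨h.1, fun _ hb hab => h.2 hb hab⟩⟩

/-- `x ∈ X^O_max ↔ H^O_X(x) ∈ Σ^{O,max}_X`. [cite: CossartJannsenSaito2020, Def. 4.9 (1), (4.3)] -/
theorem mem_hsOMaxLocus_iff [LT ν] {H : X → ν} {O : X → Set ι} {x : X} :
    x ∈ hsOMaxLocus H O ↔ hsO H O x ∈ SigmaOMax H O := by
  simp only [hsOMaxLocus, mem_iUnion, hsOStratum, mem_setOf_eq, exists_prop]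
  exact ⟨fun ⟨a, ha, hx⟩ => hx ▸ ha, fun h => ⟨_, h, rfl⟩⟩

/-- At two points with the same Hilbert–Samuel function the order of `H^O` is the order of `|O|`
("`(ν, μ) ≥ (ν', μ') ⇔ ν > ν'` or `ν = ν'` and `μ ≥ μ'`"). [cite: CossartJannsenSaito2020, Ch. 4, p. 55] -/
theorem hsO_le_hsO_iff_of_eq [Preorder ν] {H : X → ν} {O : X → Set ι} {x y : X}
    (h : H x = H y) : hsO H O x ≤ hsO H O y ↔ (O x).ncard ≤ (O y).ncard := by
  rw [hsO, hsO, Prod.Lex.toLex_le_toLex, h]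
  simp

/-! ## Lemma 6.3 (b), proof: `ν̃ = (ν, m) ∈ Σ^{O,max}` forces `ν ∈ Σ^max`, and `X^O(ν̃) ⊆ X(ν)` -/

/-- **CJS Lemma 6.3 (b), proof step:** "let `ν̃ = (ν, m)` … Then `ν ∈ Σ^max_X`" — the first
coordinate of a maximal value of `H^O_X` is a maximal value of `H_X` (for the lexicographic order
with `H` first). [cite: CossartJannsenSaito2020, Lemma 6.3 (b) (proof, p. 80)] -/
theorem maximal_fst_of_mem_sigmaOMax [PartialOrder ν] {H : X → ν} {O : X → Set ι} {a : ν ×ₗ ℕ}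
    (ha : a ∈ SigmaOMax H O) : Maximal (· ∈ range H) (ofLex a).1 := by
  obtain ⟨⟨x, rfl⟩, hmax⟩ := ha
  refine ⟨⟨x, rfl⟩, ?_⟩
  rintro _ ⟨y, rfl⟩ hxy
  -- if `H x < H y` then `H^O(x) < H^O(y)`, contradicting maximality; else `H y ≤ H x`
  by_contra hyx
  have hlt : H x < H y := lt_of_le_not_ge hxy hyx
  have hle : hsO H O x ≤ hsO H O y := Prod.Lex.toLex_le_toLex.2 (Or.inl hlt)
  have hge : hsO H O y ≤ hsO H O x := hmax _ (hsO_mem_sigmaO H O y) hle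
  rcases Prod.Lex.toLex_le_toLex.1 hge with hlt' | ⟨heq, -⟩
  · exact lt_asymm hlt hlt'
  · exact hlt.ne heq.symm

/-- **CJS Lemma 6.3 (b), proof step:** "`X^O(ν̃) ⊆ X(ν)`" for `ν̃ = (ν, m)`.
[cite: CossartJannsenSaito2020, Lemma 6.3 (b) (proof, p. 80)] -/
theorem hsOStratum_subset {H : X → ν} {O : X → Set ι} (a : ν ×ₗ ℕ) :
    hsOStratum H O a ⊆ {x | H x = (ofLex a).1} := by
  rintro x (rfl : hsO H O x = a)
  rfl

/-- Hence **`X^O_max ⊆ X_max`**: every point of the `O`-Hilbert–Samuel locus has a maximal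
Hilbert–Samuel function. [cite: CossartJannsenSaito2020, Lemma 6.3 (b) (proof, p. 80), Def. 4.9 (1)] -/
theorem hsOMaxLocus_subset_setOf_maximal [PartialOrder ν] {H : X → ν} {O : X → Set ι} :
    hsOMaxLocus H O ⊆ {x | Maximal (· ∈ range H) (H x)} := fun _ hx =>
  maximal_fst_of_mem_sigmaOMax (mem_hsOMaxLocus_iff.1 hx)

/-! ## The regular (constant `H_X`) case: `X^O_max` is the locus of maximal `|O|` -/

/-- If `H_X` is constant on `X` (e.g. `X` regular and connected, Rem. 6.22 (c)) and the histories
are finite, then `x ∈ X^O_max` iff `|O(x)|` is maximal: `|O(y)| ≤ |O(x)|` for all `y`.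
[cite: CossartJannsenSaito2020, Rem. 6.22 (c), Def. 4.9 (1)] -/
theorem mem_hsOMaxLocus_iff_of_const [PartialOrder ν] {H : X → ν} {O : X → Set ι}
    (hH : ∀ x y, H x = H y) {x : X} :
    x ∈ hsOMaxLocus H O ↔ ∀ y, (O y).ncard ≤ (O x).ncard := by
  rw [mem_hsOMaxLocus_iff]
  constructor
  · rintro ⟨-, hmax⟩ y
    rcases le_total (O y).ncard (O x).ncard with h | h
    · exact h
    · exact (hsO_le_hsO_iff_of_eq (hH y x)).1
        (hmax _ (hsO_mem_sigmaO H O y) ((hsO_le_hsO_iff_of_eq (hH x y)).2 h))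
  · intro h
    refine ⟨hsO_mem_sigmaO H O x, ?_⟩
    rintro _ ⟨y, rfl⟩ -
    exact (hsO_le_hsO_iff_of_eq (hH y x)).2 (h y)

/-- In the constant-`H_X` case a point of `X^O_max` carries an old component as soon as SOME point
does: `O(y) ≠ ∅` for some `y` (with `O(y)` finite) forces `O(x) ≠ ∅` for `x ∈ X^O_max` (so such
centres lie on the old boundary). [cite: CossartJannsenSaito2020, Rem. 6.22 (c), Def. 4.9 (1)] -/
theorem nonempty_of_mem_hsOMaxLocus_of_const [PartialOrder ν] {H : X → ν} {O : X → Set ι}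
    (hH : ∀ x y, H x = H y) {x y : X} (hx : x ∈ hsOMaxLocus H O) (hy : (O y).Nonempty)
    (hfin : (O y).Finite) : (O x).Nonempty := by
  have h := (mem_hsOMaxLocus_iff_of_const hH).1 hx y
  have hpos : 0 < (O y).ncard := (ncard_pos hfin).2 hy
  exact nonempty_of_ncard_ne_zero (by omega)

end BoundaryHistory

/-! ## On a scheme, with `H = H_X^N` (Def. 2.28): `X^O_max ⊆ X_max ⊆ X ∖ X_reg` -/

universe u

variable {X : Scheme.{u}} {ι : Type*}

/-- For `H = H_X^N` (`Scheme.hsFun`) and any history `O` on the points of `X`: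
**`X^O_max ⊆ X_max`** (Def. 2.35). [cite: CossartJannsenSaito2020, Lemma 6.3 (b) (proof, p. 80), Def. 2.35] -/
theorem hsOMaxLocus_hsFun_subset_hsMaxLocus (N : ℕ) (O : X → Set ι) :
    BoundaryHistory.hsOMaxLocus (Scheme.hsFun X N) O ⊆ Scheme.hsMaxLocus X N :=
  fun _ hx => BoundaryHistory.hsOMaxLocus_subset_setOf_maximal hx

/-- **For a non-regular scheme, `X^O_max ⊆ X ∖ X_reg`** (all local rings of dimension `≤ N`):
by `X^O_max ⊆ X_max` and Rem. 2.32 / Def. 2.35 (`Scheme.hsMaxLocus_subset_compl_regularLocus`).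
So the centres `D_i ⊆ (X_i)^O_max` of the `Σ^{O,max}`-eliminations of Def. 6.23, on a connected
non-regular reduced stage, consist of singular points. [cite: CossartJannsenSaito2020, Lemma 6.3 (b), Rem. 2.32, Def. 6.23] -/
theorem hsOMaxLocus_hsFun_subset_compl_regularLocus [IsLocallyNoetherian X] {N : ℕ}
    (hdim : ∀ x : X, ∃ d : ℕ, ringKrullDim (X.presheaf.stalk x) = d ∧ d ≤ N)
    (hX : ¬Scheme.IsRegular X) (O : X → Set ι) :
    BoundaryHistory.hsOMaxLocus (Scheme.hsFun X N) O ⊆ (Scheme.regularLocus X)ᶜ :=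
  (hsOMaxLocus_hsFun_subset_hsMaxLocus N O).trans (Scheme.hsMaxLocus_subset_compl_regularLocus hdim hX)

end Literature.AlgebraicGeometry.Resolution

end
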